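import Literature.MathematicalPhysics.QuantumFieldTheory.Balaban1983to89.B9Eq326DeltaAMajorantAssemblyZd
import Literature.MathematicalPhysics.QuantumFieldTheory.Balaban1983to89.B9Eq326DRDsKernelDecayZd
import Literature.MathematicalPhysics.QuantumFieldTheory.Balaban1983to89.B9Thm311CoerciveCompactZd
import Literature.MathematicalPhysics.QuantumFieldTheory.Balaban1983to89.B9Thm311PerMemberCubeZdUnconditional
import Literature.MathematicalPhysics.QuantumFieldTheory.Balaban1983to89.B9Thm311PlaqClosedReadingsCubeZd
import Literature.MathematicalPhysics.QuantumFieldTheory.Balaban1983to89.B8CubeMemberLevelDisjoint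

/-!
# `Balaban1983to89.B9Thm33GKernelDecayCubeMemberZd` — [Balaban1985BackgroundPropagators] Thm 3.3 p. 399 «(3.42)–(3.47) hold with G′(U) replaced by G(U)», (3.26)–(3.27)
# p. 395, Thm 3.11 p. 416, AT THE CUBE MEMBERS `{□_j}` OF [Balaban1985RegularSpaces] (1.131): THE KERNEL OF THE GENUINE `G_𝔤(U₀) = (□₀Δ_a(U₀)□₀)⁻¹`
# (dag-n06-w4's `gopZdH` over the four-letter record `opsAllZd`) DECAYS EXPONENTIALLY BETWEEN BONDS, for EVERY unitary background of the closed small-field class,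
# MODULO ONLY THE THREE LOCAL-LETTER BOUNDS (`D*D`, `Δ′`, `Q*aQ` on Hermitian single-bond bumps — displayed in dag-n06-b g21's exact shapes; everything else —
# coercivity, regularity, `Q′*`-injectivity, the `DRD*` letter, the Combes–Thomas window — is a theorem here)

statement-level skeleton of published theorems with citation tags; proofs where landed; nothing here is a claim about the
Yang–Mills mass gap

`[Balaban1985BackgroundPropagators]` ("B9", CMP **99** (1985) 389–434): Thm 3.3 p. 399, (3.42) p. 397, (3.26)–(3.27) p. 395, (3.25) p. 394, (3.63)–(3.68) pp. 404–405,
Thm 3.11 p. 416; `[Balaban1985RegularSpaces]` ("B8") (1.131) p. 99, (1.7) p. 77; `[Balaban1984PropagatorsII]` p. 226; `[Balaban1988RG2Cluster]` (2.5)–(2.7) pp. 12–13.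
HERE: the assembly at a cube member; constants crude and member-dependent, NOT print's.

CITATION HEADER (lean-in-tree rule).  Cell `pub-ymgap` (YM Track A, HUMAN RULING D-0062 ∕ D-0149 width push), DAG node N06 = [B9], width seat
`pub-ymgap-dag-n06-w2` (g4), CLAIM-14.  Inputs BY NAME: dag-n06-w4's `B9Thm311CoerciveCompactZd.exists_coercive_of_pdevOn_lt_cube` (the coercivity constant),
`B9Thm311PlaqClosedReadingsCubeZd.pdevOn_lt_of_forall_plaqF_le`, `B9Eq321LandauProjectionZd.opsLandau_DRDs_of_finite`; dag-n06-b's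
`B9Thm311PerMemberCubeZdUnconditional.regularAtH_of_pdevOn_lt_cube`, `B9Thm311PosDefOpenZd.cubeMember_Ω0_finite`; dag-n05∕n06's
`B8CubeMemberLevelDisjoint.qprimeStarInjective_of_subset_cubeLamS`, `B8Eq191FlatLettersCubeMember.cubeLamS_finite`; this seat's
`B9Eq326DRDsKernelDecayZd.exists_fnorm_DRD_bump_le_exp_plaqClosed` (station 4a), `B9Eq326DeltaAMajorantAssemblyZd.{fnorm_deltaAOf_bump_le_of_letters',
exists_fnorm_gopZdH_bump_le_exp_of_letters}` (station 5 + window).  Nothing restated.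

WHAT IS PROVED (kernel, 0 sorry, 0 def).
* `DRDs_opsAllZd_eq` — at a cube member the record's `DRD*` letter IS station 4a's letter `D^η_μ R(U₀) 𝟙_{□₀} D^{η*}` at the finsets `(□₀, cubeLamS … m ·)`.
* ★★★ `exists_fnorm_gopZdH_bump_le_exp_cubeMember_of_letters` — `2 ≤ d`, `2 ≤ L ≤ ρ`, `m ≤ i.k`, `i.Ω = cubeFam …`, `i.Λs = cubeLamS …`, `a ≥ 0`; DISPLAYED: bounds
  `|letter(δ_{b′}w)(b)|_τ ≤ B·𝟙[|b−b′|_∞ ≤ r]·|w|_τ` for the three local letters of the record at every unitary `U₀` (dag-n06-b g21's shapes).  Then there is `β₀ > 0`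
  such that for every `0 ≤ β < β₀` there are `C > 0`, `κ > 0` with `|(G_𝔤(U₀)δ_{b′}w)(b)|_τ ≤ C·e^{−κ|b−b′|_∞}·|w|_τ` for EVERY unitary `U₀` with `‖U₀(∂p) − 1‖ ≤ β`
  at all plaquettes, all bonds `b, b′` of `□₀`, Hermitian `w`.

HONEST SCOPE.  Count-neutral helper; per-member constants; the three local-letter bounds displayed (dag-n06-b g21 `B9Eq326LocalLettersBumpBoundsZd`, filing);
no estimate of [B9] with print's constants; N05 ∕ N06 NOT discharged; K1⁹ `stmt-QuantumFields-27364` NOT closed; one finite `𝕋⁴` programme at fixed `ε`, Bałaban as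
printed; R4 closes only the conditional finite-`𝕋⁴` rung `BalabanLadder.UV` — nothing continuum ∕ ℝ⁴ ∕ OS ∕ mass gap ∕ Clay.  Unit `pub-ymgap-dag-n06-w2` (g4), 2026-08-28.
-/

noncomputable section

open scoped BigOperators

namespace Literature.MathematicalPhysics.QuantumFieldTheory.Balaban1983to89.B9Thm33GKernelDecayCubeMemberZd

open B7Prop1Local (pdevOn)
open B7Prop2Explicit (unitaryUnits)
open B7Prop5Flat (bump)
open B8Ineq132 (BondTouches covDerivFwd plaqF)
open B8Eq138LandauZd (covDivB)
open B8Eq131Cubes (sqLo sqHi)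
open B8Eq131CubesAdmissible (cubeFam)
open B8CubeMemberZd (cubeLamS)
open B8Ineq159FlatCubeMemberPrinted (cubeLamBP)
open B8Eq191FlatLettersCubeMember (cubeLamS_finite)
open B8CubeMemberLevelDisjoint (qprimeStarInjective_of_subset_cubeLamS)
open B8LeafModelZd (ZdIdx)
open B8Eq155JBound (Jcur)
open B9SupplySockB9P3ZdLetters (OpsZd deltaAOf)
open B9SupplySockB9P3ZdAllLettersZd (opsAllZd)
open B9Eq321LandauProjectionZd (projR opsLandau_DRDs_of_finite)
open B9Eq327GreenZd (bondPair)
open B9Eq327GreenZdHerm (domSubH RegularAtH gopZdH)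
open B9Eq316AveragingTransposeZd (alphaQ alphaQ_pos)
open B9Eq342CombesThomasFormZd (fnorm fnorm_nonneg)
open B9Thm311PosDefOpenZd (cubeMember_Ω0_finite)
open B9Thm311CoerciveCompactZd (exists_coercive_of_pdevOn_lt_cube)
open B9Thm311PerMemberCubeZdUnconditional (regularAtH_of_pdevOn_lt_cube)
open B9Thm311PlaqClosedReadingsCubeZd (pdevOn_lt_of_forall_plaqF_le)
open B9Eq326DRDsKernelDecayZd (exists_fnorm_DRD_bump_le_exp_plaqClosed)
open B9Eq326DeltaAMajorantAssemblyZd (fnorm_deltaAOf_bump_le_of_letters' exists_fnorm_gopZdH_bump_le_exp_of_letters)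
open LatticeNorms (linfDist)

export B7Prop1Explicit (Site)

variable {d : ℕ} {𝔸 : Type*} [CStarAlgebra 𝔸] [FiniteDimensional ℝ 𝔸]
variable (τ : 𝔸 →ₗ[ℂ] ℂ) (hτp : ∀ a : 𝔸, a ≠ 0 → 0 < (τ (star a * a)).re)
  (hτt : ∀ a b : 𝔸, τ (a * b) = τ (b * a)) (hτs : ∀ a : 𝔸, τ (star a) = starRingEnd ℂ (τ a)) (L : ℕ)

/-- **THE RECORD'S `DRD*` LETTER IS STATION 4a's LETTER** at a member with finite `Ω₀`: for any finsets `Λ j` presenting `i.Λs m j`,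
`(opsAllZd …).DRDs U₀ A x μ = D^η_{U₀,μ} R(U₀) 𝟙_{Ω₀} D^{η*}_{U₀} A (x)`. [cite: Balaban1985BackgroundPropagators, (3.26) p.395 (bookkeeping)] -/
theorem DRDs_opsAllZd_eq (ΛbP : ℕ → ℕ → Set (Site d × Fin d)) (ops₀ : ℝ → ZdIdx d L → ℕ → OpsZd d 𝔸) (M : ℝ) (i : ZdIdx d L) (m : ℕ)
    (hfin : (i.Ω 0).Finite) {Λ : ℕ → Finset (Site d)} (hΛ : (fun j => (↑(Λ j) : Set (Site d))) = i.Λs m)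
    (U₀ : Site d → Fin d → 𝔸ˣ) (A : Site d → Fin d → 𝔸) (x : Site d) (μ : Fin d) :
    (opsAllZd τ L ΛbP ops₀ M i m).DRDs U₀ A x μ = covDerivFwd i.η U₀ μ (projR τ hfin.toFinset L m i.η (fun j => (↑(Λ j) : Set (Site d))) U₀ (covDivB i.η U₀ A)) x := by
  rw [hΛ, B9SupplySockB9P3ZdAllLettersZd.opsAllZd_DRDs]
  exact opsLandau_DRDs_of_finite τ _ M i m hfin U₀ A x μ

include hτp hτt hτs in
/-- ★★★ **THE KERNEL OF `G_𝔤(U₀) = (□₀Δ_a(U₀)□₀)⁻¹` DECAYS AT EVERY CUBE MEMBER, FOR EVERY UNITARY BACKGROUND OF THE CLOSED SMALL-FIELD CLASS, MODULO THE THREE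
LOCAL-LETTER BOUNDS.**  `2 ≤ d`, `2 ≤ L ≤ ρ`, `m ≤ i.k`, `i.Ω = cubeFam false L a₀ Mc ρ i.k`, `i.Λs = cubeLamS L a₀ Mc ρ i.k`, weights `a ≥ 0` (only through (3.25)),
faithful Hermitian tracial `τ`; DISPLAYED: at every unitary `U₀`, the letters `D*D` (`Jcur`), `Δ′` (`.Dp`) and `Q*aQ` (`.QQ`) of the record
`o = opsAllZd τ L (cubeLamBP …) ops₀ M i m` on Hermitian single-bond bumps are bounded by `B_•·𝟙[|b−b′|_∞ ≤ r_•]·|w|_τ`.  Then there is `β₀ > 0` such that for every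
`0 ≤ β < β₀` there are `C > 0`, `κ > 0` with:  for EVERY unitary `U₀` with `‖U₀(∂p) − 1‖ ≤ β` at all plaquettes, all bonds `b, b′` of `□₀` and Hermitian `w`,
`|(G_𝔤(U₀)δ_{b′}w)(b)|_τ ≤ C·e^{−κ|b−b′|_∞}·|w|_τ`.
[cite: Balaban1985BackgroundPropagators, Thm 3.3 p.399, (3.26)–(3.27) p.395, (3.25) p.394, Thm 3.11 p.416; Balaban1985RegularSpaces, (1.131) p.99, (1.7) p.77; Balaban1984PropagatorsII, p.226] -/
theorem exists_fnorm_gopZdH_bump_le_exp_cubeMember_of_letters [Nontrivial 𝔸] (hd2 : 2 ≤ d) (hL : 2 ≤ L) (ops₀ : ℝ → ZdIdx d L → ℕ → OpsZd d 𝔸) (M : ℝ) (i : ZdIdx d L)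
    {a₀ : Site d} {Mc ρ : ℕ} (hρ : L ≤ ρ) (hΩ : i.Ω = cubeFam false L a₀ Mc ρ i.k) (hΛs : i.Λs = cubeLamS L a₀ Mc ρ i.k) {m : ℕ} (hm : m ≤ i.k)
    (a : ℕ → ℝ) (ha : ∀ j, 0 ≤ a j) {BJ BDp BQ : ℝ} (hBJ : 0 ≤ BJ) (hBDp : 0 ≤ BDp) (hBQ : 0 ≤ BQ) (rJ rDp rQ : ℕ)
    (hLet : ∀ (U₀ : Site d → Fin d → 𝔸ˣ), (∀ x κ, U₀ x κ ∈ unitaryUnits 𝔸) → ∀ (b b' : Site d × Fin d) (w : 𝔸),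
      fnorm τ (Jcur i.η U₀ (bump b'.1 b'.2 w) b.2 b.1) ≤ BJ * (if linfDist b.1 b'.1 ≤ rJ then (1 : ℝ) else 0) * fnorm τ w ∧
      fnorm τ ((opsAllZd τ L (cubeLamBP L a₀ Mc ρ i.k) ops₀ M i m).Dp U₀ (bump b'.1 b'.2 w) b.1 b.2) ≤
        BDp * (if linfDist b.1 b'.1 ≤ rDp then (1 : ℝ) else 0) * fnorm τ w ∧
      fnorm τ ((opsAllZd τ L (cubeLamBP L a₀ Mc ρ i.k) ops₀ M i m).QQ U₀ (bump b'.1 b'.2 w) b.1 b.2) ≤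
        BQ * (if linfDist b.1 b'.1 ≤ rQ then (1 : ℝ) else 0) * fnorm τ w) :
    ∃ β₀ : ℝ, 0 < β₀ ∧ ∀ β : ℝ, 0 ≤ β → β < β₀ → ∃ C : ℝ, 0 < C ∧ ∃ κ : ℝ, 0 < κ ∧
      ∀ (U₀ : Site d → Fin d → 𝔸ˣ), (∀ x κ', U₀ x κ' ∈ unitaryUnits 𝔸) → (∀ (x : Site d) (μ ν : Fin d), ‖plaqF U₀ μ ν x - 1‖ ≤ β) →
        ∀ b b' : Site d × Fin d, BondTouches (i.Ω 0) b.1 b.2 → BondTouches (i.Ω 0) b'.1 b'.2 → ∀ w : 𝔸, IsSelfAdjoint w →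
          fnorm τ (gopZdH i.η (opsAllZd τ L (cubeLamBP L a₀ Mc ρ i.k) ops₀ M i m) (i.Ω 0) U₀ (bump b'.1 b'.2 w) b.1 b.2) ≤
            C * Real.exp (-(κ * (linfDist b.1 b'.1 : ℝ))) * fnorm τ w := by
  classical
  haveI : NeZero L := ⟨by omega⟩
  have hd : 0 < d := by omega
  have hL1 : 1 ≤ L := le_trans one_le_two hL
  have hfin : (i.Ω 0).Finite := cubeMember_Ω0_finite i hΩ
  set o := opsAllZd τ L (cubeLamBP L a₀ Mc ρ i.k) ops₀ M i m with ho
  -- regularity and coercivity on the local small-field class (dag-n06-b, dag-n06-w4)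
  obtain ⟨α₁, hα₁, hreg⟩ := regularAtH_of_pdevOn_lt_cube τ hτp hτt hτs hd2 hL ops₀ M i hρ hΩ hΛs hm
  obtain ⟨α₂, hα₂, c, hc, hcoer⟩ := exists_coercive_of_pdevOn_lt_cube τ hτp hτt hτs hd2 hL ops₀ M i hρ hΩ hΛs hm
  -- the window of station 4a
  have hwin : (0 : ℝ) < alphaQ d L / (L : ℝ) ^ 2 * (((L : ℝ) ^ m)⁻¹) ^ 2 := by
    have hα := alphaQ_pos d hL1
    have hL0 : (0 : ℝ) < L := by exact_mod_cast (lt_of_lt_of_le zero_lt_one hL1)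
    positivity
  refine ⟨min (min α₁ α₂) (alphaQ d L / (L : ℝ) ^ 2 * (((L : ℝ) ^ m)⁻¹) ^ 2), lt_min (lt_min hα₁ hα₂) hwin, fun β hβ0 hβ => ?_⟩
  have hβ1 : β < α₁ := lt_of_lt_of_le hβ ((min_le_left _ _).trans (min_le_left _ _))
  have hβ2 : β < α₂ := lt_of_lt_of_le hβ ((min_le_left _ _).trans (min_le_right _ _))
  have hβw : β < alphaQ d L / (L : ℝ) ^ 2 * (((L : ℝ) ^ m)⁻¹) ^ 2 := lt_of_lt_of_le hβ (min_le_right _ _)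
  -- the finsets presenting `□₀` and the level sets, and «Q′ onto» there
  set s : Finset (Site d) := hfin.toFinset with hs
  have hΛfin : ∀ j, (i.Λs m j).Finite := fun j => by rw [hΛs]; exact cubeLamS_finite L a₀ Mc ρ i.k m j
  set Λ : ℕ → Finset (Site d) := fun j => (hΛfin j).toFinset with hΛdef
  have hΛcoe : (fun j => (↑(Λ j) : Set (Site d))) = i.Λs m := funext fun j => Set.Finite.coe_toFinset _
  have hinj : ∀ U₀ : Site d → Fin d → 𝔸ˣ, (∀ x κ, U₀ x κ ∈ unitaryUnits 𝔸) → B9Eq325QGGQInvZd.QprimeStarInjective L U₀ τ hτp m Λ s := by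
    intro U₀ _
    refine qprimeStarInjective_of_subset_cubeLamS a₀ Mc hρ hm (Λ := Λ) (s := s) (fun j _ y hy => ?_) (fun x hx => ?_) U₀ τ hτp hτs
    · have hy' : y ∈ i.Λs m j := (Set.Finite.mem_toFinset _).mp hy
      rwa [hΛs] at hy'
    · rw [hs, Set.Finite.coe_toFinset, hΩ]; exact hx
  -- station 4a on the closed class (this seat's K)
  obtain ⟨CD, hCD, κD, hκD, hK⟩ := exists_fnorm_DRD_bump_le_exp_plaqClosed L i.η τ hτp hτt hτs m a Λ s hd hL i.hη.ne' ha hβw hinj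
  -- station 5 + window (this seat's M)
  obtain ⟨C, hC, κ, hκ, hM⟩ := exists_fnorm_gopZdH_bump_le_exp_of_letters τ hτp hτs (max rJ (max rDp rQ)) hc
    (add_nonneg (add_nonneg hBJ hBDp) hBQ) hCD.le hκD
  refine ⟨C, hC, κ, hκ, fun U₀ hU hplaq b b' hb hb' w hw => ?_⟩
  have hlo : pdevOn (fun i' => sqLo L a₀ ρ i.k 0 i' - 3) (fun i' => sqHi L a₀ Mc ρ i.k 0 i' + 3) U₀ < min α₁ α₂ :=
    pdevOn_lt_of_forall_plaqF_le hβ0 (lt_min hβ1 hβ2) hplaq _ _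
  have hregU := (hreg U₀ hU (lt_of_lt_of_le hlo (min_le_left _ _))).1
  have hcoU := hcoer U₀ hU (lt_of_lt_of_le hlo (min_le_right _ _))
  refine hM i.η o (i.Ω 0) hfin U₀ hregU hcoU (fun e e' he he' v hv => ?_) b b' hb hb' w hw
  obtain ⟨hJ, hDp, hQQ⟩ := hLet U₀ hU e e' v
  refine fnorm_deltaAOf_bump_le_of_letters' τ hτp hτs i.η o U₀ hBJ hBDp hBQ (le_max_left _ _) ((le_max_left _ _).trans (le_max_right _ _))
    ((le_max_right _ _).trans (le_max_right _ _)) e e' v hJ hDp ?_ hQQ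
  rw [ho, DRDs_opsAllZd_eq τ L (cubeLamBP L a₀ Mc ρ i.k) ops₀ M i m hfin hΛcoe]
  exact hK U₀ hU hplaq e'.1 e'.2 e.2 e.1 v hv

end Literature.MathematicalPhysics.QuantumFieldTheory.Balaban1983to89.B9Thm33GKernelDecayCubeMemberZd

end
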